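import Summits.NavierStokesRegularity.NavierStokesRegularity.Theorems.FilamentSkeletonRssNoExactProfileAdjointEnergy
import Summits.NavierStokesRegularity.NavierStokesRegularity.Theorems.FilamentSkeletonRssNoExactProfileExpBarrier

/-!
# Route `FilamentSkeletonRss` · negative item `NoExactProfileNearSymmetricPair` (stmt-NavierStokesRegularity-24091) — S_γ groundwork (B7):
# the FREIDLIN–WENTZELL UPPER BOUND for the vorticity of an exact profile, as ONE theorem with the two open inputs as hypotheses

Helper file (theorems only), `--supports stmt-NavierStokesRegularity-24091 --as helper`; LEAD of 23611 / registrar of 23920, lane ns-filament-21221-p1 g15.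

This is the (M-c) shell of the LEAD memo `Cruxes/TransverseReductionRJ/Lines/defect_column_gate_1AR_B2_gamma_LEAD15.md` §3: `vorticityOp_curl_eq_zero_of_exact_profile` +
`vorticityOp_normSq_subsolution` (file `…AdjointEnergy`) feed `exp_barrier_bound` (file `…ExpBarrier`).  For an EXACT rotating-Leray profile `U` (`E_α(U) + ∇P = 0`) and a
bounded open region `D` on which (i) the strain along the vorticity is at most `s ≤ 1` (`⟪DU·Ω, Ω⟫ ≤ s|Ω|²`), (ii) the frame field `v = U + ½y − αe₃×y` is bounded, and (iii) a
`C²` quasi-potential `Φ` satisfies the viscous Hamilton–Jacobi inequality `Γ‖∇Φ‖² ≤ ΔΦ − DΦ[v] + (2 − 2s)/Γ`, the bound `|Ω|² ≤ M·e^{−ΓΦ}` PROPAGATES from `∂D` to `D̄`.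
What remains open for the memo's upper-bound sub-programme (A2)(i) is exactly the two hypotheses: the boundary values (interior regularity from the C⁰ window clause, (M-a))
and the quasi-potential for the frozen drift ((M-b)).  It does NOT decide 24091 (memo (A5)).
HONEST FRAMING: groundwork on the NEGATIVE side of a HYPOTHETICAL filament-type rotating-self-similar blow-up route (MODEL rung); 24091/23611/23920 OPEN; nothing here bears on
Navier–Stokes regularity, which is NOT proved.
-/

set_option linter.dupNamespace false

noncomputable section

namespace Summit.NavierStokesRegularity.NavierStokesRegularity.Theorems.DefectColumnGate

open scoped BigOperators Topology InnerProductSpace Laplacian ContDiff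
open Set Function Metric
open Literature.Analysis.FluidPDE
open Summit.NavierStokesRegularity.NavierStokesRegularity.Theorems.KelvinGate

/-- **FREIDLIN–WENTZELL UPPER BOUND FOR THE VORTICITY OF AN EXACT PROFILE (conditional on boundary data and a quasi-potential).**  Let `U ∈ C³` be solenoidal with
`E_α(U) + ∇P = 0` (`P ∈ C²`), `Ω = curl U`, and let `D ⊆ ℝ³` be bounded open with: `‖U + ½y − αe₃×y‖ ≤ B₀` on `D`; `⟪DU·Ω, Ω⟫ ≤ s|Ω|²` on `D` for some `s ≤ 1`;
`Φ ∈ C²`, `Γ > 0` with `Γ‖∇Φ‖² ≤ ΔΦ + DΦ[−(U + ½y − αe₃×y)] + (2 − 2s)/Γ` on `D`; and `|Ω|² ≤ M·e^{−ΓΦ}` on `∂D` (`M ≥ 0`).  Then `|Ω|² ≤ M·e^{−ΓΦ}` on `D̄`. -/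
theorem vorticity_normSq_exp_barrier_of_exact_profile (α : ℝ) {U : EuclideanSpace ℝ (Fin 3) → EuclideanSpace ℝ (Fin 3)} {P : EuclideanSpace ℝ (Fin 3) → ℝ}
    (hU : ContDiff ℝ 3 U) (hdiv : VectorCalculus.IsDivFree U) (hP : ContDiff ℝ 2 P) (hprof : ∀ y, lerayOp α U y + gradient P y = 0)
    {D : Set (EuclideanSpace ℝ (Fin 3))} (hD : IsOpen D) (hDb : Bornology.IsBounded D)
    {Φ : EuclideanSpace ℝ (Fin 3) → ℝ} (hΦ : ContDiff ℝ 2 Φ) {Γ B₀ s M : ℝ} (hΓ : 0 < Γ) (hB₀ : 0 ≤ B₀) (hs : s ≤ 1) (hM : 0 ≤ M)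
    (hb : ∀ y ∈ D, ‖U y + (1/2:ℝ) • y - α • cross (EuclideanSpace.single 2 1) y‖ ≤ B₀)
    (hstrain : ∀ y ∈ D, ⟪fderiv ℝ U y (curl U y), curl U y⟫_ℝ ≤ s * ⟪curl U y, curl U y⟫_ℝ)
    (hHJ : ∀ y ∈ D, Γ * ‖gradient Φ y‖ ^ 2 ≤ (Δ Φ) y + fderiv ℝ Φ y (-(U y + (1/2:ℝ) • y - α • cross (EuclideanSpace.single 2 1) y)) + (2 - 2 * s) / Γ)
    (hbdry : ∀ y ∈ frontier D, ⟪curl U y, curl U y⟫_ℝ ≤ M * Real.exp (-Γ * Φ y)) :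
    ∀ y ∈ closure D, ⟪curl U y, curl U y⟫_ℝ ≤ M * Real.exp (-Γ * Φ y) := by
  have hΩ : ContDiff ℝ 2 (curl U) := contDiff_curl (n := 2) (by exact_mod_cast hU)
  have hq : ContDiff ℝ 2 (fun z => ⟪curl U z, curl U z⟫_ℝ) := hΩ.inner ℝ hΩ
  have he : ‖(EuclideanSpace.single 2 (1:ℝ) : EuclideanSpace ℝ (Fin 3))‖ = 1 := by rw [PiLp.norm_single, norm_one]
  have hV0 : (0:ℝ) ≤ 2 - 2 * s := by linarith
  -- `|Ω|²` is a subsolution of `−Δ − b·∇ + (2 − 2s)` with `b = −v`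
  have hsub : ∀ y ∈ D, -(Δ (fun z => ⟪curl U z, curl U z⟫_ℝ)) y
      - fderiv ℝ (fun z => ⟪curl U z, curl U z⟫_ℝ) y (-(U y + (1/2:ℝ) • y - α • cross (EuclideanSpace.single 2 1) y))
      + (fun _ : EuclideanSpace ℝ (Fin 3) => 2 - 2 * s) y * ⟪curl U y, curl U y⟫_ℝ ≤ 0 := by
    intro y hy
    have hvort := vorticityOp_curl_eq_zero_of_exact_profile α hU hdiv hP hprof y
    have h := vorticityOp_normSq_subsolution α hΩ (hstrain y hy) hvort
    rw [map_neg]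
    simp only
    linarith
  exact exp_barrier_bound hD hDb he hΦ hq hΓ hB₀ hV0 (b := fun y => -(U y + (1/2:ℝ) • y - α • cross (EuclideanSpace.single 2 1) y))
    (V := fun _ => 2 - 2 * s) (fun y hy => by rw [norm_neg]; exact hb y hy) (fun _ _ => hV0) (fun _ _ => le_rfl)
    (fun y hy => hHJ y hy) hsub hM hbdry

end Summit.NavierStokesRegularity.NavierStokesRegularity.Theorems.DefectColumnGate

end
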